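import Literature.NumberTheory.Transcendental.RoyRankGenericDefs
import Literature.Barriers.Schanuel.AlgebraicIndependenceOfLogarithmsRoyThm3
import Literature.Barriers.Schanuel.AlgebraicIndependenceOfLogarithmsThm4FromThm2B
import HarnessLib

/-!
# Roy 1992 over a general field: the objects of Roy's proofs (category `𝒞` of §2, map `φ` of §4)

Second definition file of the field-generic rendering of [Roy1992] begun in
`Literature.NumberTheory.Transcendental.RoyRankGenericDefs` (data: `K` a field of characteristic
`0`, `F : IntermediateField ℚ K` playing `ℚ̄`, `L : Submodule ℚ K` playing `L`, `ω : K`). It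
introduces, WITHOUT any assertion, the auxiliary objects that Roy's proofs of Theorem 2 (§§2–3) and
Theorem 4 (§4) manipulate, so that the proof files that follow are theorem-only:

* §2 (pp. 26–27), the category `𝒞`: `RoyRank.IsBiRational F f` (the two rationality conditions on
  morphisms, so that `IsAdmissible F f ↔ Surjective f ∧ IsBiRational F f`); `RoyRank.Obj F L`
  ("the families `(K^{d₀} × K^{d₁}, Y, W, V)` where `d₀, d₁, Y, W, V` are as in Theorem 1");
  `Obj.IsCokerMap`, `Obj.IsKerMap` (cokernels and kernels of `𝒞`); morphisms are products `f₀ × f₁` of a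
  matrix over `F` and a matrix over `ℚ` (`exists_eq_prodMap_of_isBiRational`), whence the image object
  `Obj.mapObj` (`X' = (K^{d₀'} × K^{d₁'}, s(Y), s(W), s(V))`, "Then `X'` is an object of `𝒞`", p. 29); the functions
  `fa, fb, fc, fd, fr, fd₀, fd₁ : Obj F L → ℕ` (`a(X) = d₁ − dim_ℚ(Y ∩ Ω)`,
  `b(X) = d₀ + d₁ − dim_K(V)`, `c(X) = dim_ℚ(Y)`, `d(X) = dim_K(V/W)`, `r(X) = d₀ + d₁`, `d₀(X)`,
  `d₁(X)`, p. 27); and `RoyRank.royCat` — Roy's category as an arrow-free admissible category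
  (`Literature.Barriers.Schanuel.Roy1992.AdmissibleCat`, the abstract setting in which the tree
  proves Roy's Theorem 3), TAKING AS ARGUMENTS the two halves of Proposition 1 ("any kernel of `𝒞`
  admits a cokernel in `𝒞` and, vice versa, any cokernel of `𝒞` admits a kernel in `𝒞`", proved in
  a later companion) — identities and composition of kernels/cokernels are proved here.
* Notations (p. 24) on `K^{d₀} × K^{d₁}`: the flattening `flat K d₀ d₁ : K^{d₀} × K^{d₁} ≃ K^{d₀+d₁}`,
  the `F`-structure `qPts F d₀ d₁ = F^{d₀} × F^{d₁}` as an `F`-subspace, and the `F`-points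
  `qOf F T = T ∩ (F^{d₀} × F^{d₁})` of a `K`-subspace `T`.
* §4 (p. 35), the proof of Theorem 4: Roy's map `φ : K^d × (K^d)^m → K^d`,
  `(x, (y_μ)) ↦ x + ∑ η_μ y_μ` for a `ℚ`-basis `η` of an intermediate field `k` (`RoyRank.phi η`, on
  `LinTangent K d (m·d)`, the factor `(K^d)^m` flattened by `finProdFinEquiv`, built from the
  ring-generic `Roy1992.psi` of the tree's `K = ℂ` companion, imported), the graph map `kerGraph η`
  of `ker φ`, the basis elements seen in `F ⊇ k` (`etaF`), `ψ_η` at the levels `ℚ^{md} → F^d` and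
  `ℚ^{md} → k^d` (`psiF`, `psiK`), and the `ℚ`-subspace `k^d × L^{md}` (`goodSubspace`) in which
  the space `Y` of p. 35 is taken.

Everything is a definition with a body or a small structural lemma (identities, composition,
membership); the field-generic versions of the tree's `Literature.Barriers.Schanuel.Roy1992.Obj`,
`IsBiRational`, `Obj.IsCokerMap/IsKerMap`, `Obj.mapObj`, `fa…fd₁`, `cat`, `flat`, `qPts`, `qOf`, `phi`,
`kerGraph`, `etaQbar`, `psiQbar`, `psiK`, `goodSubspace` (all hard-wired to `K = ℂ` there).

## References

* [Roy1992] D. Roy, *Matrices whose coefficients are linear forms in logarithms*, J. Number Theory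
  41 (1992) 22–47: Notations (p. 24); §2 (pp. 26–27: objects, morphisms, kernels, cokernels, the
  functions `a, b, c, d, r, d₀, d₁`; Proposition 1); §4 proof of Theorem 4 (p. 35: `k`, `η`, `φ`,
  `Y`, `W`); Remark (i) (p. 37).
-/

noncomputable section

open Module Submodule
open Literature.Barriers.Schanuel.Roy1992 (AdmissibleCat incl incl_apply psi psi_apply)

namespace Literature.NumberTheory.Transcendental.RoyRank

variable {K : Type*} [Field K] [CharZero K]
variable {d₀ d₁ d₀' d₁' d₀'' d₁'' : ℕ}

/-! ### Morphisms of `𝒞`: the two rationality conditions -/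

/-- The rationality conditions on the underlying linear map of a morphism of `𝒞`:
`f(F^{d₀} × 0) ⊆ F^{d₀'} × 0` and `f(0 × ℚ^{d₁}) ⊆ 0 × ℚ^{d₁'}` (so that `IsAdmissible F f` is
`Surjective f ∧ IsBiRational F f`). [cite: Roy1992, §2 (p. 26)] -/
def IsBiRational (F : IntermediateField ℚ K) (f : LinTangent K d₀ d₁ →ₗ[K] LinTangent K d₀' d₁') :
    Prop :=
  (∀ x : Fin d₀ → K, (∀ i, x i ∈ F) → (∀ i, (f (x, 0)).1 i ∈ F) ∧ (f (x, 0)).2 = 0) ∧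
    (∀ y : Fin d₁ → K, (∀ j, y j ∈ Set.range (algebraMap ℚ K)) →
      (f (0, y)).1 = 0 ∧ ∀ j, (f (0, y)).2 j ∈ Set.range (algebraMap ℚ K))

/-- `IsAdmissible F f ↔ Surjective f ∧ IsBiRational F f` (by definition).
[cite: Roy1992, §1 Theorem 1 (p. 25)] -/
theorem isAdmissible_iff (F : IntermediateField ℚ K)
    (f : LinTangent K d₀ d₁ →ₗ[K] LinTangent K d₀' d₁') :
    IsAdmissible F f ↔ Function.Surjective f ∧ IsBiRational F f := Iff.rfl

/-- The identity is a morphism. [folklore] -/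
theorem IsBiRational.id (F : IntermediateField ℚ K) (d₀ d₁ : ℕ) :
    IsBiRational F (LinearMap.id : LinTangent K d₀ d₁ →ₗ[K] LinTangent K d₀ d₁) :=
  (isAdmissible_id F d₀ d₁).2

/-- Morphisms compose. [cite: Roy1992, §2 (p. 26)] -/
theorem IsBiRational.comp {F : IntermediateField ℚ K}
    {g : LinTangent K d₀' d₁' →ₗ[K] LinTangent K d₀'' d₁''}
    {f : LinTangent K d₀ d₁ →ₗ[K] LinTangent K d₀' d₁'} (hg : IsBiRational F g)
    (hf : IsBiRational F f) : IsBiRational F (g ∘ₗ f) := by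
  refine ⟨fun x hx => ?_, fun y hy => ?_⟩
  · obtain ⟨h1, h2⟩ := hf.1 x hx
    have hfx : f (x, 0) = ((f (x, 0)).1, 0) := by ext1 <;> simp [h2]
    rw [LinearMap.comp_apply, hfx]
    exact hg.1 _ h1
  · obtain ⟨h1, h2⟩ := hf.2 y hy
    have hfy : f (0, y) = (0, (f (0, y)).2) := by ext1 <;> simp [h1]
    rw [LinearMap.comp_apply, hfy]
    exact hg.2 _ h2

/-- Admissible maps compose. [folklore] -/
theorem isAdmissible_comp {F : IntermediateField ℚ K}
    {g : LinTangent K d₀' d₁' →ₗ[K] LinTangent K d₀'' d₁''}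
    {f : LinTangent K d₀ d₁ →ₗ[K] LinTangent K d₀' d₁'} (hg : IsAdmissible F g)
    (hf : IsAdmissible F f) : IsAdmissible F (g ∘ₗ f) :=
  ⟨hg.1.comp hf.1, IsBiRational.comp hg.2 hf.2⟩

variable {F : IntermediateField ℚ K} {L : Submodule ℚ K}

/-- **Morphisms are products `f₀ × f₁`** of a map given by a matrix over `F` and a map given by a
matrix over `ℚ` (the off-diagonal blocks of `f` vanish on the standard bases, the diagonal blocks
have matrices with entries in `F`, resp. `ℚ`). [cite: Roy1992, §2 proof of Proposition 2 (p. 28) and §4 (p. 35)] -/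
theorem exists_eq_prodMap_of_isBiRational {F : IntermediateField ℚ K}
    {f : LinTangent K d₀ d₁ →ₗ[K] LinTangent K d₀' d₁'} (hf : IsBiRational F f) :
    ∃ (A₀ : Matrix (Fin d₀') (Fin d₀) F) (A₁ : Matrix (Fin d₁') (Fin d₁) ℚ),
      f = (A₀.map (algebraMap F K)).mulVecLin.prodMap (A₁.map (algebraMap ℚ K)).mulVecLin := by
  obtain ⟨h0, h1⟩ := hf
  set f₀ : (Fin d₀ → K) →ₗ[K] (Fin d₀' → K) :=
    LinearMap.fst K _ _ ∘ₗ f ∘ₗ LinearMap.inl K _ _ with hf₀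
  set f₁ : (Fin d₁ → K) →ₗ[K] (Fin d₁' → K) :=
    LinearMap.snd K _ _ ∘ₗ f ∘ₗ LinearMap.inr K _ _ with hf₁
  have hsingle0 : ∀ i : Fin d₀, ∀ k, (Pi.single i (1 : K) : Fin d₀ → K) k ∈ F := by
    intro i k
    by_cases h : k = i
    · subst h; simp
    · simp [h]
  have hsingle1 : ∀ j : Fin d₁, ∀ k,
      (Pi.single j (1 : K) : Fin d₁ → K) k ∈ Set.range (algebraMap ℚ K) := by
    intro j k
    by_cases h : k = j
    · subst h; exact ⟨1, by simp⟩
    · exact ⟨0, by simp [h]⟩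
  have hoff0 : (LinearMap.snd K _ _ ∘ₗ f ∘ₗ LinearMap.inl K _ (Fin d₁ → K)) = 0 :=
    Literature.Barriers.Schanuel.Roy1992.eq_zero_of_forall_single _ fun i => (h0 _ (hsingle0 i)).2
  have hoff1 : (LinearMap.fst K _ _ ∘ₗ f ∘ₗ LinearMap.inr K (Fin d₀ → K) _) = 0 :=
    Literature.Barriers.Schanuel.Roy1992.eq_zero_of_forall_single _ fun j => (h1 _ (hsingle1 j)).1
  have hdec : ∀ x y, f (x, y) = (f₀ x, f₁ y) := by
    intro x y
    have hx : f (x, 0) = (f₀ x, 0) := by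
      ext1
      · rfl
      · exact congrArg (fun g => g x) (congrArg DFunLike.coe hoff0)
    have hy : f (0, y) = (0, f₁ y) := by
      ext1
      · exact congrArg (fun g => g y) (congrArg DFunLike.coe hoff1)
      · rfl
    calc f (x, y) = f ((x, 0) + (0, y)) := by simp
      _ = (f₀ x, f₁ y) := by rw [map_add, hx, hy]; simp
  have hA₀mem : ∀ i j, LinearMap.toMatrix' f₀ i j ∈ F := by
    intro i j
    rw [LinearMap.toMatrix'_apply]
    exact (h0 _ (hsingle0 j)).1 i
  have hA₁mem : ∀ i j, LinearMap.toMatrix' f₁ i j ∈ Set.range (algebraMap ℚ K) := by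
    intro i j
    rw [LinearMap.toMatrix'_apply]
    exact (h1 _ (hsingle1 j)).2 i
  let A₀ : Matrix (Fin d₀') (Fin d₀) F := fun i j => ⟨_, hA₀mem i j⟩
  let A₁ : Matrix (Fin d₁') (Fin d₁) ℚ := fun i j => Classical.choose (hA₁mem i j)
  have hA₀ : A₀.map (algebraMap F K) = LinearMap.toMatrix' f₀ := by
    ext i j; rfl
  have hA₁ : A₁.map (algebraMap ℚ K) = LinearMap.toMatrix' f₁ := by
    ext i j
    exact Classical.choose_spec (hA₁mem i j)
  have hm₀ : (A₀.map (algebraMap F K)).mulVecLin = f₀ := by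
    rw [hA₀, ← Matrix.toLin'_apply', Matrix.toLin'_toMatrix']
  have hm₁ : (A₁.map (algebraMap ℚ K)).mulVecLin = f₁ := by
    rw [hA₁, ← Matrix.toLin'_apply', Matrix.toLin'_toMatrix']
  refine ⟨A₀, A₁, ?_⟩
  rw [hm₀, hm₁]
  refine LinearMap.ext fun q => ?_
  obtain ⟨x, y⟩ := q
  rw [hdec, LinearMap.prodMap_apply]

/-- A product `f₀ × f₁` of a map given by a matrix over `F` and a map given by a matrix over `ℚ` is
a morphism. [cite: Roy1992, §2 (p. 26)] -/
theorem isBiRational_prodMap (A₀ : Matrix (Fin d₀') (Fin d₀) F) (A₁ : Matrix (Fin d₁') (Fin d₁) ℚ) :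
    IsBiRational F ((A₀.map (algebraMap F K)).mulVecLin.prodMap
      (A₁.map (algebraMap ℚ K)).mulVecLin) := by
  refine ⟨fun x hx => ⟨fun i => ?_, ?_⟩, fun y hy => ⟨?_, fun j => ?_⟩⟩
  · simp only [LinearMap.prodMap_apply, Matrix.mulVecLin_apply, Matrix.mulVec, dotProduct,
      Matrix.map_apply]
    exact sum_mem fun j _ => mul_mem (SetLike.coe_mem _) (hx j)
  · simp
  · simp
  · simp only [LinearMap.prodMap_apply, Matrix.mulVecLin_apply, Matrix.mulVec, dotProduct,
      Matrix.map_apply]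
    choose q hq using hy
    refine ⟨∑ k, A₁ j k * q k, ?_⟩
    rw [map_sum]
    exact Finset.sum_congr rfl fun k _ => by rw [map_mul, hq k]

/-- Morphisms map `F`-points to `F`-points. [cite: Roy1992, §2 (p. 26)] -/
theorem IsBiRational.isFPoint {f : LinTangent K d₀ d₁ →ₗ[K] LinTangent K d₀' d₁'}
    (hf : IsBiRational F f) {v : LinTangent K d₀ d₁} (hv : IsFPoint F v) : IsFPoint F (f v) := by
  obtain ⟨A₀, A₁, rfl⟩ := exists_eq_prodMap_of_isBiRational hf
  obtain ⟨x, y⟩ := v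
  refine ⟨fun i => ?_, fun j => ?_⟩
  · simp only [LinearMap.prodMap_apply, Matrix.mulVecLin_apply, Matrix.mulVec, dotProduct,
      Matrix.map_apply]
    exact sum_mem fun k _ => mul_mem (SetLike.coe_mem _) (hv.1 k)
  · simp only [LinearMap.prodMap_apply, Matrix.mulVecLin_apply, Matrix.mulVec, dotProduct,
      Matrix.map_apply]
    exact sum_mem fun k _ => mul_mem (IntermediateField.algebraMap_mem F _) (hv.2 k)

/-- Morphisms map `ℚ`-subspaces of `F^{d₀} × L^{d₁}` to `ℚ`-subspaces of `F^{d₀'} × L^{d₁'}` (the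
second block is a matrix over `ℚ`, and `L` is a `ℚ`-subspace). [cite: Roy1992, §2 (p. 26)] -/
theorem IsBiRational.isFLogSubspace_map {f : LinTangent K d₀ d₁ →ₗ[K] LinTangent K d₀' d₁'}
    (hf : IsBiRational F f) {Y : Submodule ℚ (LinTangent K d₀ d₁)} (hY : IsFLogSubspace F L Y) :
    IsFLogSubspace F L (Y.map (f.restrictScalars ℚ)) := by
  obtain ⟨A₀, A₁, rfl⟩ := exists_eq_prodMap_of_isBiRational hf
  rintro _ ⟨⟨x, y⟩, hyY, rfl⟩
  obtain ⟨hx, hy⟩ := hY _ hyY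
  refine ⟨fun i => ?_, fun j => ?_⟩
  · simp only [LinearMap.restrictScalars_apply, LinearMap.prodMap_apply, Matrix.mulVecLin_apply,
      Matrix.mulVec, dotProduct, Matrix.map_apply]
    exact sum_mem fun k _ => mul_mem (SetLike.coe_mem _) (hx k)
  · simp only [LinearMap.restrictScalars_apply, LinearMap.prodMap_apply, Matrix.mulVecLin_apply,
      Matrix.mulVec, dotProduct, Matrix.map_apply]
    refine sum_mem fun k _ => ?_
    rw [← Algebra.smul_def]
    exact L.smul_mem _ (hy k)

/-- Morphisms map subspaces rational over `F` to subspaces rational over `F`.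
[cite: Roy1992, §2 (p. 26)] -/
theorem IsBiRational.isFRational_map {f : LinTangent K d₀ d₁ →ₗ[K] LinTangent K d₀' d₁'}
    (hf : IsBiRational F f) {W : Submodule K (LinTangent K d₀ d₁)} (hW : IsFRational F W) :
    IsFRational F (W.map f) := by
  unfold IsFRational at hW ⊢
  refine le_antisymm ?_ (Submodule.span_le.2 fun v hv => hv.1)
  have h1 : W.map f = Submodule.span K (f '' {v | v ∈ W ∧ IsFPoint F v}) := by
    conv_lhs => rw [hW]
    rw [LinearMap.map_span]
  refine h1.le.trans (Submodule.span_mono ?_)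
  rintro _ ⟨v, ⟨hvW, hvq⟩, rfl⟩
  exact ⟨Submodule.mem_map_of_mem hvW, hf.isFPoint hvq⟩

/-! ### Objects, cokernels and kernels of `𝒞` -/

/-- **The objects of Roy's category `𝒞`** over the data `(K, F, L)`: "the families
`(K^{d₀} × K^{d₁}, Y, W, V)` where `d₀, d₁, Y, W, V` are as in Theorem 1" — `Y` a
finite-dimensional `ℚ`-subspace of `K^{d₀} × K^{d₁}` contained in `F^{d₀} × L^{d₁}`, `W` a
`K`-subspace rational over `F`, `V` a `K`-subspace containing `Y` and `W`. [cite: Roy1992, §2 (p. 26)] -/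
structure Obj (F : IntermediateField ℚ K) (L : Submodule ℚ K) where
  /-- `d₀` -/
  d₀ : ℕ
  /-- `d₁` -/
  d₁ : ℕ
  /-- `Y ⊆ F^{d₀} × L^{d₁}`, a finite-dimensional `ℚ`-subspace -/
  Y : Submodule ℚ (LinTangent K d₀ d₁)
  /-- `W`, a `K`-subspace rational over `F` -/
  W : Submodule K (LinTangent K d₀ d₁)
  /-- `V ⊇ Y, W` -/
  V : Submodule K (LinTangent K d₀ d₁)
  finite : FiniteDimensional ℚ Y
  isLog : IsFLogSubspace F L Y
  isRat : IsFRational F W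
  hYV : Y ≤ V.restrictScalars ℚ
  hWV : W ≤ V

/-- `Y` is finite dimensional over `ℚ`. [cite: Roy1992, §1 Theorem 1 (p. 25)] -/
instance Obj.instFiniteDimensionalY (X : Obj F L) : FiniteDimensional ℚ X.Y := X.finite

namespace Obj

/-- **Cokernels of `𝒞`**: "`(X, X', s)` is a cokernel of `𝒞` if the linear mapping `s` is
surjective and satisfies `Y' = s(Y)`, `W' = s(W)`, `V' = s(V)`" (`s` a morphism).
[cite: Roy1992, §2 (p. 26)] -/
def IsCokerMap (X X' : Obj F L) (s : LinTangent K X.d₀ X.d₁ →ₗ[K] LinTangent K X'.d₀ X'.d₁) :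
    Prop :=
  IsAdmissible F s ∧ X'.Y = X.Y.map (s.restrictScalars ℚ) ∧ X'.W = X.W.map s ∧ X'.V = X.V.map s

/-- **Kernels of `𝒞`**: "`(X*, X, i)` is a kernel of `𝒞` if the linear mapping `i` is injective and
satisfies `Y* = i⁻¹(Y)`, `W* = i⁻¹(W)`, `V* = i⁻¹(V)`" (`i` a morphism). [cite: Roy1992, §2 (p. 26)] -/
def IsKerMap (A X : Obj F L) (i : LinTangent K A.d₀ A.d₁ →ₗ[K] LinTangent K X.d₀ X.d₁) : Prop :=
  Function.Injective i ∧ IsBiRational F i ∧ A.Y = X.Y.comap (i.restrictScalars ℚ) ∧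
    A.W = X.W.comap i ∧ A.V = X.V.comap i

/-- The identity is a cokernel `X → X`. [folklore] -/
theorem isCokerMap_id (X : Obj F L) : X.IsCokerMap X LinearMap.id :=
  ⟨isAdmissible_id F _ _, by simp [LinearMap.restrictScalars_id], by simp, by simp⟩

/-- The identity is a kernel `X → X`. [folklore] -/
theorem isKerMap_id (X : Obj F L) : X.IsKerMap X LinearMap.id :=
  ⟨Function.injective_id, IsBiRational.id F _ _, by simp [LinearMap.restrictScalars_id], by simp,
    by simp⟩

/-- Cokernels compose. [cite: Roy1992, §2 Proposition 1 (p. 27)] -/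
theorem IsCokerMap.comp {X X' X'' : Obj F L}
    {s : LinTangent K X.d₀ X.d₁ →ₗ[K] LinTangent K X'.d₀ X'.d₁}
    {s' : LinTangent K X'.d₀ X'.d₁ →ₗ[K] LinTangent K X''.d₀ X''.d₁} (hs : X.IsCokerMap X' s)
    (hs' : X'.IsCokerMap X'' s') : X.IsCokerMap X'' (s' ∘ₗ s) := by
  obtain ⟨h1, h2, h3, h4⟩ := hs
  obtain ⟨h1', h2', h3', h4'⟩ := hs'
  refine ⟨isAdmissible_comp h1' h1, ?_, ?_, ?_⟩
  · rw [h2', h2, LinearMap.restrictScalars_comp, Submodule.map_comp]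
  · rw [h3', h3, Submodule.map_comp]
  · rw [h4', h4, Submodule.map_comp]

/-- Kernels compose. [cite: Roy1992, §2 Proposition 1 (p. 27)] -/
theorem IsKerMap.comp {A' A X : Obj F L}
    {i' : LinTangent K A'.d₀ A'.d₁ →ₗ[K] LinTangent K A.d₀ A.d₁}
    {i : LinTangent K A.d₀ A.d₁ →ₗ[K] LinTangent K X.d₀ X.d₁} (hi' : A'.IsKerMap A i')
    (hi : A.IsKerMap X i) : A'.IsKerMap X (i ∘ₗ i') := by
  obtain ⟨h1, h2, h3, h4, h5⟩ := hi
  obtain ⟨h1', h2', h3', h4', h5'⟩ := hi'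
  refine ⟨h1.comp h1', h2.comp h2', ?_, ?_, ?_⟩
  · rw [h3', h3, LinearMap.restrictScalars_comp, Submodule.comap_comp]
  · rw [h4', h4, Submodule.comap_comp]
  · rw [h5', h5, Submodule.comap_comp]

/-- **The image object** `X' = (K^{d₀'} × K^{d₁'}, s(Y), s(W), s(V))` of a bi-rational map `s`:
"Then `X'` is an object of `𝒞`". [cite: Roy1992, §2 proof of Proposition 3 (p. 29)] -/
def mapObj (X : Obj F L) (s : LinTangent K X.d₀ X.d₁ →ₗ[K] LinTangent K d₀' d₁')
    (hs : IsBiRational F s) : Obj F L where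
  d₀ := d₀'
  d₁ := d₁'
  Y := X.Y.map (s.restrictScalars ℚ)
  W := X.W.map s
  V := X.V.map s
  finite := inferInstance
  isLog := hs.isFLogSubspace_map X.isLog
  isRat := hs.isFRational_map X.isRat
  hYV := by
    rw [Submodule.map_le_iff_le_comap]
    intro y hy
    exact ⟨y, X.hYV hy, rfl⟩
  hWV := Submodule.map_mono X.hWV

/-- `s(X)` lives in `K^{d₀'} × K^{d₁'}`. [folklore] -/
@[simp] theorem mapObj_d₀ (X : Obj F L) (s : LinTangent K X.d₀ X.d₁ →ₗ[K] LinTangent K d₀' d₁')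
    (hs : IsBiRational F s) : (X.mapObj s hs).d₀ = d₀' := rfl

/-- `s(X)` lives in `K^{d₀'} × K^{d₁'}`. [folklore] -/
@[simp] theorem mapObj_d₁ (X : Obj F L) (s : LinTangent K X.d₀ X.d₁ →ₗ[K] LinTangent K d₀' d₁')
    (hs : IsBiRational F s) : (X.mapObj s hs).d₁ = d₁' := rfl

/-- `Y' = s(Y)`. [cite: Roy1992, §2 (p. 26)] -/
@[simp] theorem mapObj_Y (X : Obj F L) (s : LinTangent K X.d₀ X.d₁ →ₗ[K] LinTangent K d₀' d₁')
    (hs : IsBiRational F s) : (X.mapObj s hs).Y = X.Y.map (s.restrictScalars ℚ) := rfl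

/-- `W' = s(W)`. [cite: Roy1992, §2 (p. 26)] -/
@[simp] theorem mapObj_W (X : Obj F L) (s : LinTangent K X.d₀ X.d₁ →ₗ[K] LinTangent K d₀' d₁')
    (hs : IsBiRational F s) : (X.mapObj s hs).W = X.W.map s := rfl

/-- `V' = s(V)`. [cite: Roy1992, §2 (p. 26)] -/
@[simp] theorem mapObj_V (X : Obj F L) (s : LinTangent K X.d₀ X.d₁ →ₗ[K] LinTangent K d₀' d₁')
    (hs : IsBiRational F s) : (X.mapObj s hs).V = X.V.map s := rfl

/-- `(X, s(X), s)` is a cokernel for every admissible `s`. [cite: Roy1992, §2 proof of Proposition 3 (p. 29)] -/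
theorem isCokerMap_mapObj (X : Obj F L) {s : LinTangent K X.d₀ X.d₁ →ₗ[K] LinTangent K d₀' d₁'}
    (hs : IsAdmissible F s) : X.IsCokerMap (X.mapObj s hs.2) s :=
  ⟨hs, rfl, rfl, rfl⟩

end Obj

/-- **Roy's category `𝒞` as an arrow-free admissible category** (`Roy1992.AdmissibleCat`, the
abstract setting of Roy's Theorem 3 in the tree): kernels/cokernels are given by the maps
`IsKerMap`/`IsCokerMap`, exact triples `(X*, X, X')` are "a kernel `X* → X` admitting as cokernel a
morphism `X → X'`" (`Im(i) = ker(s)`); admissibility — Proposition 1: "Any kernel of `𝒞` admits a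
cokernel in `𝒞` and, vice versa, any cokernel of `𝒞` admits a kernel in `𝒞`" — is taken as the
two ARGUMENTS `hK`, `hC` (proved in the companion on kernels), the closure of kernels and
cokernels under identities and composition being proved above.
[cite: Roy1992, §2 Proposition 1 (p. 27) and §3 (p. 29)] -/
def royCat
    (hK : ∀ (A X : Obj F L) (i : LinTangent K A.d₀ A.d₁ →ₗ[K] LinTangent K X.d₀ X.d₁),
      A.IsKerMap X i → ∃ (B : Obj F L) (s : LinTangent K X.d₀ X.d₁ →ₗ[K] LinTangent K B.d₀ B.d₁),
        X.IsCokerMap B s ∧ LinearMap.range i = LinearMap.ker s)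
    (hC : ∀ (X B : Obj F L) (s : LinTangent K X.d₀ X.d₁ →ₗ[K] LinTangent K B.d₀ B.d₁),
      X.IsCokerMap B s → ∃ (A : Obj F L) (i : LinTangent K A.d₀ A.d₁ →ₗ[K] LinTangent K X.d₀ X.d₁),
        A.IsKerMap X i ∧ LinearMap.range i = LinearMap.ker s) :
    AdmissibleCat (Obj F L) where
  IsKer A X := ∃ i, A.IsKerMap X i
  IsCoker X B := ∃ s, X.IsCokerMap B s
  Exact A X B := ∃ (i : LinTangent K A.d₀ A.d₁ →ₗ[K] LinTangent K X.d₀ X.d₁)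
    (s : LinTangent K X.d₀ X.d₁ →ₗ[K] LinTangent K B.d₀ B.d₁),
    A.IsKerMap X i ∧ X.IsCokerMap B s ∧ LinearMap.range i = LinearMap.ker s
  isKer_refl X := ⟨_, X.isKerMap_id⟩
  isCoker_refl X := ⟨_, X.isCokerMap_id⟩
  isKer_trans := fun ⟨_, hi⟩ ⟨_, hj⟩ => ⟨_, hi.comp hj⟩
  isCoker_trans := fun ⟨_, hs⟩ ⟨_, ht⟩ => ⟨_, hs.comp ht⟩
  isKer_of_exact := fun ⟨i, _, hi, _, _⟩ => ⟨i, hi⟩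
  isCoker_of_exact := fun ⟨_, s, _, hs, _⟩ => ⟨s, hs⟩
  exists_exact_of_isKer := fun ⟨i, hi⟩ => by
    obtain ⟨B, s, hs, h⟩ := hK _ _ i hi
    exact ⟨B, i, s, hi, hs, h⟩
  exists_exact_of_isCoker := fun ⟨s, hs⟩ => by
    obtain ⟨A, i, hi, h⟩ := hC _ _ s hs
    exact ⟨A, i, s, hi, hs, h⟩

/-! ### The functions `a, b, c, d, r, d₀, d₁` -/

/-- `a(X) = d₁ − dim_ℚ(Y ∩ Ω)`, `Ω = 0 × ωℚ^{d₁}`. [cite: Roy1992, §2 (p. 27)] -/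
def fa (ω : K) (X : Obj F L) : ℕ := X.d₁ - finrank ℚ ↥(X.Y ⊓ Omega ω X.d₀ X.d₁)

/-- `b(X) = d₀ + d₁ − dim_K(V)`. [cite: Roy1992, §2 (p. 27)] -/
def fb (X : Obj F L) : ℕ := X.d₀ + X.d₁ - finrank K X.V

/-- `c(X) = dim_ℚ(Y)`. [cite: Roy1992, §2 (p. 27)] -/
def fc (X : Obj F L) : ℕ := finrank ℚ X.Y

/-- `d(X) = dim_K(V/W)` (`= dim_K V − dim_K W`, `W ⊆ V`). [cite: Roy1992, §2 (p. 27)] -/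
def fd (X : Obj F L) : ℕ := finrank K X.V - finrank K X.W

/-- `r(X) = d₀ + d₁`. [cite: Roy1992, §2 (p. 27)] -/
def fr (X : Obj F L) : ℕ := X.d₀ + X.d₁

/-- `d₀(X) = d₀`. [cite: Roy1992, §2 (p. 27)] -/
def fd₀ (X : Obj F L) : ℕ := X.d₀

/-- `d₁(X) = d₁`. [cite: Roy1992, §2 (p. 27)] -/
def fd₁ (X : Obj F L) : ℕ := X.d₁

/-! ### `K^{d₀} × K^{d₁}`: flattening, `F`-points -/

variable (K) in
/-- The coordinate identification `K^{d₀} × K^{d₁} ≃ K^{d₀+d₁}` (first the `d₀` coordinates, then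
the `d₁`). [folklore] -/
def flat (d₀ d₁ : ℕ) : LinTangent K d₀ d₁ ≃ₗ[K] (Fin (d₀ + d₁) → K) where
  toFun v := Fin.append v.1 v.2
  invFun w := (fun i => w (Fin.castAdd d₁ i), fun j => w (Fin.natAdd d₀ j))
  map_add' v w := by
    funext k
    refine Fin.addCases (fun i => ?_) (fun j => ?_) k <;> simp
  map_smul' c v := by
    funext k
    refine Fin.addCases (fun i => ?_) (fun j => ?_) k <;> simp
  left_inv v := by
    ext i <;> simp
  right_inv w := by
    funext k
    refine Fin.addCases (fun i => ?_) (fun j => ?_) k <;> simp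

variable (F) in
/-- The `F`-points `F^{d₀} × F^{d₁}` of `K^{d₀} × K^{d₁}`, as an `F`-subspace (the `F`-structure).
[cite: Roy1992, Notations (p. 24)] -/
def qPts (d₀ d₁ : ℕ) : Submodule F (LinTangent K d₀ d₁) where
  carrier := {v | IsFPoint F v}
  add_mem' := by
    rintro v w ⟨hv1, hv2⟩ ⟨hw1, hw2⟩
    exact ⟨fun i => add_mem (hv1 i) (hw1 i), fun j => add_mem (hv2 j) (hw2 j)⟩
  zero_mem' := ⟨fun _ => zero_mem _, fun _ => zero_mem _⟩
  smul_mem' := by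
    rintro c v ⟨hv1, hv2⟩
    refine ⟨fun i => ?_, fun j => ?_⟩
    · rw [Prod.smul_fst, Pi.smul_apply, IntermediateField.smul_def, smul_eq_mul]
      exact mul_mem c.2 (hv1 i)
    · rw [Prod.smul_snd, Pi.smul_apply, IntermediateField.smul_def, smul_eq_mul]
      exact mul_mem c.2 (hv2 j)

/-- Membership in `qPts`. [folklore] -/
@[simp] theorem mem_qPts {v : LinTangent K d₀ d₁} : v ∈ qPts F d₀ d₁ ↔ IsFPoint F v := Iff.rfl

variable (F) in
/-- The `F`-points of a `K`-subspace `T`: `T ∩ (F^{d₀} × F^{d₁})` as an `F`-subspace.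
[cite: Roy1992, Notations (p. 24)] -/
def qOf (T : Submodule K (LinTangent K d₀ d₁)) : Submodule F (LinTangent K d₀ d₁) :=
  T.restrictScalars F ⊓ qPts F d₀ d₁

/-- Membership in `qOf`. [folklore] -/
@[simp] theorem mem_qOf {T : Submodule K (LinTangent K d₀ d₁)} {v : LinTangent K d₀ d₁} :
    v ∈ qOf F T ↔ v ∈ T ∧ IsFPoint F v := Iff.rfl

/-! ### The map `φ` of §4 and its companions -/

section Phi

variable {d m : ℕ} {k : IntermediateField ℚ K} (η : Basis (Fin m) ℚ k)

/-- **Roy's map `φ : K^d × (K^d)^m → K^d`, `(x, y) ↦ x + ∑_μ η_μ y_μ`**, on `LinTangent K d (m·d)`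
(`ψ_e y = ∑ e_μ y_μ` is the tree's ring-generic `Roy1992.psi`). [cite: Roy1992, §4 proof of Theorem 4 (p. 35)] -/
def phi : LinTangent K d (m * d) →ₗ[K] (Fin d → K) :=
  LinearMap.fst K _ _ + psi (fun μ => ((η μ : k) : K)) ∘ₗ LinearMap.snd K _ _

/-- `φ (x, y) = x + ψ_η y`. [cite: Roy1992, §4 proof of Theorem 4 (p. 35)] -/
@[simp] theorem phi_apply (q : LinTangent K d (m * d)) :
    phi η q = q.1 + psi (fun μ => ((η μ : k) : K)) q.2 := rfl

/-- The graph map `y ↦ (−ψ_η y, y)` (whose range is `ker φ`). [folklore] -/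
def kerGraph : (Fin (m * d) → K) →ₗ[K] LinTangent K d (m * d) :=
  LinearMap.prod (-(psi fun μ => ((η μ : k) : K))) LinearMap.id

/-- `kerGraph η y = (−ψ_η y, y)`. [folklore] -/
@[simp] theorem kerGraph_apply (y : Fin (m * d) → K) :
    kerGraph (d := d) η y = (-(psi (fun μ => ((η μ : k) : K)) y), y) := rfl

/-- The basis elements `η_μ` as elements of an intermediate field `F ⊇ k`. [folklore] -/
def etaF (hkF : k ≤ F) (μ : Fin m) : F := ⟨((η μ : k) : K), hkF (η μ).2⟩

/-- `etaF` coerces to `η_μ`. [folklore] -/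
@[simp] theorem coe_etaF (hkF : k ≤ F) (μ : Fin m) : (etaF η hkF μ : K) = ((η μ : k) : K) := rfl

/-- `ψ_η` at the level `ℚ^{md} → F^d` (`F ⊇ k`). [cite: Roy1992, §4 proof of Theorem 4 (p. 36)] -/
def psiF (hkF : k ≤ F) : (Fin (m * d) → ℚ) →ₗ[ℚ] (Fin d → F) :=
  (psi (etaF η hkF)).restrictScalars ℚ ∘ₗ incl ℚ F (m * d)

/-- `ψ_η` at the level `ℚ^{md} → k^d`. [cite: Roy1992, §4 proof of Theorem 4 (p. 36)] -/
def psiK : (Fin (m * d) → ℚ) →ₗ[ℚ] (Fin d → k) :=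
  (psi fun μ => (η μ : k)).restrictScalars ℚ ∘ₗ incl ℚ k (m * d)

/-- `psiF` unfolds to `ψ` composed with the inclusion. [folklore] -/
theorem psiF_apply (hkF : k ≤ F) (y : Fin (m * d) → ℚ) :
    psiF (d := d) η hkF y = psi (etaF η hkF) (incl ℚ F (m * d) y) := rfl

/-- `psiK` unfolds to `ψ` composed with the inclusion. [folklore] -/
theorem psiK_apply (y : Fin (m * d) → ℚ) :
    psiK (d := d) η y = psi (fun μ => (η μ : k)) (incl ℚ k (m * d) y) := rfl

variable (L) in
/-- The `ℚ`-subspace `k^d × L^{md}` of `K^d × K^{md}`, which contains the chosen `φ`-preimages of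
p. 35 and is contained in `F^{d₀} × L^{d₁}` when `k ⊆ F`. [cite: Roy1992, §4 proof of Theorem 4 (p. 35)] -/
def goodSubspace (d m : ℕ) (k : IntermediateField ℚ K) : Submodule ℚ (LinTangent K d (m * d)) :=
  (Submodule.pi Set.univ fun _ : Fin d =>
      (Subalgebra.toSubmodule k.toSubalgebra : Submodule ℚ K)).prod
    (Submodule.pi Set.univ fun _ : Fin (m * d) => L)

/-- Membership in `goodSubspace`. [folklore] -/
theorem mem_goodSubspace {q : LinTangent K d (m * d)} :
    q ∈ goodSubspace L d m k ↔ (∀ i, q.1 i ∈ k) ∧ ∀ j, q.2 j ∈ L := by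
  simp [goodSubspace, Submodule.mem_prod, Submodule.mem_pi]

end Phi

end Literature.NumberTheory.Transcendental.RoyRank
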